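import Mathlib
import Summits.Ventures.PercRepro2.Defs
import Summits.Ventures.PercRepro2.Independence
import Summits.Ventures.PercRepro2.Harris
import Summits.Ventures.PercRepro2.Graph
import Summits.Ventures.PercRepro2.Exploration
import Summits.Ventures.PercRepro2.Events
import Summits.Ventures.PercRepro2.FourFunctions
import Summits.Ventures.PercRepro2.Induced
import Summits.Ventures.PercRepro2.Frontier
import Summits.Ventures.PercRepro2.ObsIndependence
import Summits.Ventures.PercRepro2.BHK
import Summits.Ventures.PercRepro2.BHKEvents
import Summits.Ventures.PercRepro2.VdBKahn
import Summits.Ventures.PercRepro2.BHKAvoid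
import Summits.Ventures.PercRepro2.OrderPreservation
import Summits.Ventures.PercRepro2.OrderPreservationQuant
import Summits.Ventures.PercRepro2.Merge
import Summits.Ventures.PercRepro2.OrderPreservationUnion
import Summits.Ventures.PercRepro2.R2PrimeThreeReduction
import Summits.Ventures.PercRepro2.YBridge
import Summits.Ventures.PercRepro2.EdgeBHK
import Summits.Ventures.PercRepro2.N0
import Summits.Ventures.PercRepro2.Rungs
import Summits.Ventures.PercRepro2.HF2
import Summits.Ventures.PercRepro2.ZIdentities

/-!
# The reduction of record: `R2′(3) ⇐ (Yu1Δ) ∧ (Yu2Δ)` (blind cell PercRepro2, p1; identities in `ZIdentities`)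

Roots `o, b, a₁` (light), `a₂` (heavy), `a₃` (= `a*`, the minimiser); `Ũ = C₁ ∪ C₂`,
`D̃ = {a₃ ∉ Ũ}`, `PD = D̃ ∩ {C₁ ≠ C₂}`, `x | y` = `{x, y ∈ Ũ in different clusters}`
(`UnionCluster.split`), `φ = P(o ∈ Ũ | D̃)`, `W = M₂ + Δ_T` (`YBridge`).

* `Δ := P(o | a₃, o ↔ b) − P(o | a₃, a₃ ↔ b)` splits as `Δ_l + Δ_h` by the cluster of `o`
  (`delta_split`), with `Δ_l = P(C₁ ≠ C₂, o ∈ C₁, a₃ ∈ C₂, b ∈ C₁) − P(C₁ ≠ C₂, o ∈ C₁, a₃ ∈ C₂, b ∈ C₂)`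
  and `Δ_h` its mirror (`proofs/LEAD-PROOFSHAPES.md` §8.9 ADDENDUM 12 (1));
* `gap_prime_eq`: `P(b ∈ Ũ) − P(a₃ ↔ b) − P(a₃ | b) = mb − m₃`, so `c′ · gap′ = φ · (mb − m₃)`;
* `corr_eq`: `P(o | b) − P(a₃ | b, o ∈ Ũ) = split − Δ`; hence `SC′-slack = SC″-slack + Δ`
  (ADDENDUM 11 (B));
* `scprime_of_Z`: the two conjectured pieces **(Yu1Δ)** `(T_{l→h} − Δ_l)·P(PD) ≤ P(PD, o ∈ C₁)·W` and
  **(Yu2Δ)** `(T_{h→l} − Δ_h)·P(PD) ≤ P(PD, o ∈ C₂)·W` (rows 2′Y1Δ / 2′Y2Δ), together with the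
  theorem (N0) `P(o ∈ Ũ | PD) ≤ φ` (`n0`) and the orders `P(a₃ ↔ b) ≤ P(a₁ ↔ b) ≤ P(a₂ ↔ b)`,
  give **SC′** (`SCPrimeIneq`, mine-2's hypothesis `hSC`, with `a* = a₃`);
* `r2prime3_of_Z`: composed with `UnionCluster.r2prime3_of_quant_of_SC` and the quantitative R10
  in the merged graph (`orderPreserving_quant_union`): **R2′(3)** — `P(o ↔ A, o ↔ b) ≥ P(o ↔ A, a₃ ↔ b)`
  for `A = {a₃, a₁, a₂}`.

So the Lean chain of record is `R2′(3) ⇐ (Yu1Δ) ∧ (Yu2Δ)`, every other link a theorem.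
-/

namespace Summit.Ventures.PercRepro2

open UnionCluster

section ZReduction

variable {V : Type*} {E : Type*} [Fintype E] [DecidableEq E] [Fintype V] [DecidableEq V]
  {R : Type*} [Field R] [LinearOrder R] [IsStrictOrderedRing R]

omit [Fintype E] [DecidableEq E] [Fintype V] [DecidableEq V] in
/-- Under `PD`, `{o ∈ C₁}` and `{o ∈ C₂}` are disjoint. -/
lemma zr_PD_disjoint_o (ends : E → Sym2 V) (o a₁ a₂ a₃ : V) :
    Disjoint (PDEvent ends a₁ a₂ a₃ ∩ connEvent ends a₁ o)
      (PDEvent ends a₁ a₂ a₃ ∩ connEvent ends a₂ o) := by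
  rw [Set.disjoint_left]
  rintro ω ⟨⟨h12, _⟩, h1o⟩ ⟨_, h2o⟩
  exact h12 (conn_trans h1o (conn_symm h2o))

omit [Fintype E] [DecidableEq E] [Fintype V] [DecidableEq V] in
/-- `{o ∈ Ũ} ∩ PD = (PD ∩ {o ∈ C₁}) ∪ (PD ∩ {o ∈ C₂})`. -/
lemma zr_inU_PD_eq_union (ends : E → Sym2 V) (o a₁ a₂ a₃ : V) :
    inU ends a₁ a₂ o ∩ PDEvent ends a₁ a₂ a₃ =
      (PDEvent ends a₁ a₂ a₃ ∩ connEvent ends a₁ o) ∪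
        (PDEvent ends a₁ a₂ a₃ ∩ connEvent ends a₂ o) := by
  ext ω
  simp only [inU, Set.mem_inter_iff, Set.mem_union, mem_connEvent]
  constructor
  · rintro ⟨h, hPD⟩
    rcases h with h | h
    · exact Or.inl ⟨hPD, conn_symm h⟩
    · exact Or.inr ⟨hPD, conn_symm h⟩
  · rintro (⟨hPD, h⟩ | ⟨hPD, h⟩)
    · exact ⟨Or.inl (conn_symm h), hPD⟩
    · exact ⟨Or.inr (conn_symm h), hPD⟩

/-- **SC′ from (Yu1Δ) ∧ (Yu2Δ)** (rows 2′Y1Δ / 2′Y2Δ as hypotheses, in product form), with (N0)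
(`n0`) and the orders `P(a₃ ↔ b) ≤ P(a₁ ↔ b) ≤ P(a₂ ↔ b)`: `SCPrimeIneq p ends o a₃ a₁ a₂ b`
(mine-2's `hSC` with `a* = a₃` and `Ũ = C(a₁) ∪ C(a₂)`). -/
theorem scprime_of_Z (p : E → R) (hp : IsProbVec p) (ends : E → Sym2 V) {o a₁ a₂ a₃ b : V}
    (h12 : a₁ ≠ a₂) (h31 : a₃ ≠ a₁) (ho : o ≠ a₁) (hPD : 0 < prob p (PDEvent ends a₁ a₂ a₃))
    (hZ1 : (prob p (PDEvent ends a₁ a₂ a₃ ∩ connEvent ends a₁ o ∩ connEvent ends a₂ b) -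
        (prob p ((connEvent ends a₁ a₂)ᶜ ∩ connEvent ends a₁ o ∩ connEvent ends a₂ a₃ ∩
            connEvent ends a₁ b) -
          prob p ((connEvent ends a₁ a₂)ᶜ ∩ connEvent ends a₁ o ∩ connEvent ends a₂ a₃ ∩
            connEvent ends a₂ b))) * prob p (PDEvent ends a₁ a₂ a₃) ≤
      prob p (PDEvent ends a₁ a₂ a₃ ∩ connEvent ends a₁ o) *
        (massM2 p ends a₁ a₂ a₃ b + deltaT p ends a₁ a₂ a₃ b))
    (hZ2 : (prob p (PDEvent ends a₁ a₂ a₃ ∩ connEvent ends a₂ o ∩ connEvent ends a₁ b) -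
        (prob p ((connEvent ends a₁ a₂)ᶜ ∩ connEvent ends a₂ o ∩ connEvent ends a₁ a₃ ∩
            connEvent ends a₂ b) -
          prob p ((connEvent ends a₁ a₂)ᶜ ∩ connEvent ends a₂ o ∩ connEvent ends a₁ a₃ ∩
            connEvent ends a₁ b))) * prob p (PDEvent ends a₁ a₂ a₃) ≤
      prob p (PDEvent ends a₁ a₂ a₃ ∩ connEvent ends a₂ o) *
        (massM2 p ends a₁ a₂ a₃ b + deltaT p ends a₁ a₂ a₃ b))
    (hord : prob p (connEvent ends a₁ b) ≤ prob p (connEvent ends a₂ b))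
    (h3 : prob p (connEvent ends a₃ b) ≤ prob p (connEvent ends a₁ b)) :
    SCPrimeIneq p ends o a₃ a₁ a₂ b := by
  unfold SCPrimeIneq
  rw [gap_prime_eq, corr_eq]
  have hphi : prob p (inU ends a₁ a₂ o ∩ (inU ends a₁ a₂ a₃)ᶜ) / prob p (inU ends a₁ a₂ a₃)ᶜ =
      phi p ends o a₁ a₂ a₃ := rfl
  rw [hphi]
  set W := massM2 p ends a₁ a₂ a₃ b + deltaT p ends a₁ a₂ a₃ b with hW
  have hW0 : 0 ≤ W := by
    have h1 : 0 ≤ massM2 p ends a₁ a₂ a₃ b := prob_nonneg hp _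
    have h2 : 0 ≤ deltaT p ends a₁ a₂ a₃ b := by
      have := hf2_deltaT_nonneg p hp ends a₂ a₁ a₃ b hord
      unfold deltaT TEvent
      exact this
    linarith
  -- (Yu1Δ) + (Yu2Δ): `(split − Δ) · P(PD) ≤ P(PD, o ∈ Ũ) · W`
  have hsum : prob p (PDEvent ends a₁ a₂ a₃ ∩ connEvent ends a₁ o) +
      prob p (PDEvent ends a₁ a₂ a₃ ∩ connEvent ends a₂ o) =
      prob p (inU ends a₁ a₂ o ∩ PDEvent ends a₁ a₂ a₃) := by
    rw [zr_inU_PD_eq_union, prob_union_of_disjoint p (zr_PD_disjoint_o ends o a₁ a₂ a₃)]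
  have hdelta := delta_split p ends o a₁ a₂ a₃ b
  have hZ : (splitMass p ends o a₁ a₂ a₃ b -
      (prob p (split ends a₁ a₂ o a₃ ∩ connEvent ends o b) -
        prob p (split ends a₁ a₂ o a₃ ∩ connEvent ends a₃ b))) * prob p (PDEvent ends a₁ a₂ a₃) ≤
      prob p (inU ends a₁ a₂ o ∩ PDEvent ends a₁ a₂ a₃) * W := by
    unfold splitMass
    rw [← hsum, hdelta, add_mul]
    have e1 := hZ1
    have e2 := hZ2
    rw [sub_mul] at e1 e2 ⊢
    nlinarith [e1, e2]
  -- (N0): `P(o ∈ Ũ | PD) ≤ φ`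
  have hn0 := n0 p hp ends h12 h31 ho hPD
  have hle : splitMass p ends o a₁ a₂ a₃ b -
      (prob p (split ends a₁ a₂ o a₃ ∩ connEvent ends o b) -
        prob p (split ends a₁ a₂ o a₃ ∩ connEvent ends a₃ b)) ≤ phi p ends o a₁ a₂ a₃ * W := by
    have h1 : prob p (inU ends a₁ a₂ o ∩ PDEvent ends a₁ a₂ a₃) * W ≤
        phi p ends o a₁ a₂ a₃ * W * prob p (PDEvent ends a₁ a₂ a₃) := by
      rw [div_le_iff₀ hPD] at hn0
      calc prob p (inU ends a₁ a₂ o ∩ PDEvent ends a₁ a₂ a₃) * W ≤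
          phi p ends o a₁ a₂ a₃ * prob p (PDEvent ends a₁ a₂ a₃) * W :=
            mul_le_mul_of_nonneg_right hn0 hW0
        _ = phi p ends o a₁ a₂ a₃ * W * prob p (PDEvent ends a₁ a₂ a₃) := by ring
    exact le_of_mul_le_mul_right (hZ.trans h1) hPD
  -- `φ · W ≤ φ · (mb − m₃)` by `Y_slack_eq` and the order `P(a₃ ↔ b) ≤ P(a₁ ↔ b)`
  have hY := Y_slack_eq p ends o a₁ a₂ a₃ b
  have hphi0 : 0 ≤ phi p ends o a₁ a₂ a₃ := phi_nonneg hp ends o a₁ a₂ a₃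
  have hmargin : phi p ends o a₁ a₂ a₃ *
      (prob p (connEvent ends a₃ b) - prob p (connEvent ends a₁ b)) ≤ 0 :=
    mul_nonpos_of_nonneg_of_nonpos hphi0 (by linarith)
  rw [ge_iff_le]
  rw [← hW] at hY
  linarith

/-- **R2′(3) from (Yu1Δ) ∧ (Yu2Δ)** — the Lean chain of record: with the hypotheses of
`scprime_of_Z` (plus the distinctness needed by the merged-graph step), for `A = {a₃, a₁, a₂}`,
`P(o ↔ A, o ↔ b) ≥ P(o ↔ A, a₃ ↔ b)` (Kozma–Nitzan's pre-FKG inequality (3) at the minimiser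
`a₃`, `#A = 3`), via `UnionCluster.r2prime3_of_quant_of_SC` and `orderPreserving_quant_union`. -/
theorem r2prime3_of_Z (p : E → R) (hp : IsProbVec p) (ends : E → Sym2 V) {o a₁ a₂ a₃ b : V}
    (h12 : a₁ ≠ a₂) (h31 : a₃ ≠ a₁) (h32 : a₃ ≠ a₂) (ho : o ≠ a₁) (ho2 : o ≠ a₂) (hb2 : b ≠ a₂)
    (hPD : 0 < prob p (PDEvent ends a₁ a₂ a₃))
    (hZ1 : (prob p (PDEvent ends a₁ a₂ a₃ ∩ connEvent ends a₁ o ∩ connEvent ends a₂ b) -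
        (prob p ((connEvent ends a₁ a₂)ᶜ ∩ connEvent ends a₁ o ∩ connEvent ends a₂ a₃ ∩
            connEvent ends a₁ b) -
          prob p ((connEvent ends a₁ a₂)ᶜ ∩ connEvent ends a₁ o ∩ connEvent ends a₂ a₃ ∩
            connEvent ends a₂ b))) * prob p (PDEvent ends a₁ a₂ a₃) ≤
      prob p (PDEvent ends a₁ a₂ a₃ ∩ connEvent ends a₁ o) *
        (massM2 p ends a₁ a₂ a₃ b + deltaT p ends a₁ a₂ a₃ b))
    (hZ2 : (prob p (PDEvent ends a₁ a₂ a₃ ∩ connEvent ends a₂ o ∩ connEvent ends a₁ b) -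
        (prob p ((connEvent ends a₁ a₂)ᶜ ∩ connEvent ends a₂ o ∩ connEvent ends a₁ a₃ ∩
            connEvent ends a₂ b) -
          prob p ((connEvent ends a₁ a₂)ᶜ ∩ connEvent ends a₂ o ∩ connEvent ends a₁ a₃ ∩
            connEvent ends a₁ b))) * prob p (PDEvent ends a₁ a₂ a₃) ≤
      prob p (PDEvent ends a₁ a₂ a₃ ∩ connEvent ends a₂ o) *
        (massM2 p ends a₁ a₂ a₃ b + deltaT p ends a₁ a₂ a₃ b))
    (hord : prob p (connEvent ends a₁ b) ≤ prob p (connEvent ends a₂ b))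
    (h3 : prob p (connEvent ends a₃ b) ≤ prob p (connEvent ends a₁ b)) :
    prob p (hitEvent ends o {a₃, a₁, a₂} ∩ connEvent ends o b) ≥
      prob p (hitEvent ends o {a₃, a₁, a₂} ∩ connEvent ends a₃ b) :=
  r2prime3_of_quant_of_SC p ends o a₃ a₁ a₂ b
    (orderPreserving_quant_union p hp ends h12 ho2 h32 hb2)
    (scprime_of_Z p hp ends h12 h31 ho hPD hZ1 hZ2 hord h3)

end ZReduction

end Summit.Ventures.PercRepro2
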